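import Summits.BirchSwinnertonDyer.BirchSwinnertonDyer.Theorems.ManinLocalTwoThreeCDivisionGaloisEngine
import HarnessLib

/-!
# E-an-152d IN THE KERNEL (anchor form): index `4` ∧ `|c₀| = 2` ⟹ the three `2`-torsion abscissae are RATIONAL
(route `ManinLocalTwoThree`, crux C2 `ManinOddAtFour` stmt-BirchSwinnertonDyer-22967; cell bsd-f2-manin, prover p3 gen 19; brick 5 of the kernel port of
-an's row E-an-152d `IndexFourForcesFullRationalTwoTorsion`, in the `2 ∣ c₀` form in which the line `cdivision_udc` meets it)

From the Galois engine (`…CDivisionGaloisEngine.false_of_conj_moves_class`): every automorphism `σ` of `ℂ` permutes the three half-period values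
`e_α = ℘_{Λ_W}(α)` (roots of the rational cubic `4x³ − g₂x − g₃`), and cannot move any of them (`ringEquiv_apply_weierstrassP_eq`); hence each
`e_α` is rational (the fixed field of `Aut ℂ` is `ℚ`, tree `exists_ratCast_eq_of_forall_ringEquiv`).  With the lattice clause `Λ_W = c₀Λ₀(f)`,
`|c₀| = 2` and `Λ₁(f) = 2Λ₀(f)` the classes are `0, ω₁/2, ω₂/2, (ω₁+ω₂)/2` and the abscissae `e − b₂/12` are the `x`-coordinates of the three
rational `2`-torsion points of `W` (`HasRationalTwoTorsionX`):
* `cubic_root_cases` — a fourth root of a cubic with three distinct roots is one of them;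
* `ringEquiv_apply_weierstrassP_eq`, `exists_ratCast_eq_weierstrassP` — `σ(e_α) = e_α`; `e_α ∈ ℚ` (GIVEN the anchor hypothesis);
* `hasRationalTwoTorsionX_of_ratCast_eq` — a rational half-period value gives a rational `2`-torsion abscissa (the identity
  `4x³ + b₂x² + 2b₄x + b₆ = 4e³ − (c₄/12)e − c₆/216` at `x = e − b₂/12`);
* **`exists_three_hasRationalTwoTorsionX_of_indexFour_of_anchor`** — E-an-152d♭: lattice clause ∧ `|c₀| = 2` ∧ index `4` ∧ ANCHOR ⟹ three distinct
  rational `2`-torsion abscissae.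
HONEST FRAMING: the anchor hypothesis (existence of rational nowhere-vanishing forms with every even quadratic sign character of `Γ₀(N)`, classically
`η`-quotients) is an explicit binder here, discharged in a sequel; E-an-152d as typed (no `|c₀| = 2`), E-an-152e, C2, Manin's conjecture and BSD are NOT
proved by this file.  No definitions, no sorry. [cite: ShimuraIATAF1971, Thm. 3.52] [cite: Lawden1989, §6.8] [cite: SilvermanAEC2009, III.1 and VI.3.6]
-/

set_option autoImplicit false
-- lint-debt: the directory name repeats the summit name (sibling precedent `ManinLocalTwoThreeCDivisionGaloisEngine.lean`)
set_option linter.dupNamespace false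

noncomputable section

open scoped Topology PeriodPair MatrixGroups ModularForm Manifold Classical
open Complex Filter PowerSeries CongruenceSubgroup
open UpperHalfPlane hiding I
open WeierstrassCurve Literature.NumberTheory.EllipticCurves Literature.NumberTheory.EllipticCurves.ModularForms

namespace Summit.BirchSwinnertonDyer.BirchSwinnertonDyer.Theorems.ManinLocalTwoThree.CDivTranslate

variable {N : ℕ} [NeZero N]

/-! ## §1 A cubic has at most three roots -/

/-- A root of `4x³ − g₂x − g₃` is one of three given DISTINCT roots. [folklore] -/
theorem cubic_root_cases {e₁ e₂ e₃ r g₂ g₃ : ℂ} (h₁ : 4 * e₁ ^ 3 - g₂ * e₁ - g₃ = 0) (h₂ : 4 * e₂ ^ 3 - g₂ * e₂ - g₃ = 0)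
    (h₃ : 4 * e₃ ^ 3 - g₂ * e₃ - g₃ = 0) (hr : 4 * r ^ 3 - g₂ * r - g₃ = 0) (h12 : e₁ ≠ e₂) (h13 : e₁ ≠ e₃) (h23 : e₂ ≠ e₃) :
    r = e₁ ∨ r = e₂ ∨ r = e₃ := by
  -- any two distinct roots `u ≠ v` satisfy `4(u² + uv + v²) = g₂`; any three `u, v, w` pairwise distinct: `w = −u − v`
  have key : ∀ {u v : ℂ}, 4 * u ^ 3 - g₂ * u - g₃ = 0 → 4 * v ^ 3 - g₂ * v - g₃ = 0 → u ≠ v → 4 * (u ^ 2 + u * v + v ^ 2) = g₂ := by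
    intro u v hu hv huv
    have h : (u - v) * (4 * (u ^ 2 + u * v + v ^ 2) - g₂) = 0 := by linear_combination hu - hv
    rcases mul_eq_zero.mp h with h | h
    · exact absurd (sub_eq_zero.mp h) huv
    · exact sub_eq_zero.mp h
  have third : ∀ {u v w : ℂ}, 4 * u ^ 3 - g₂ * u - g₃ = 0 → 4 * v ^ 3 - g₂ * v - g₃ = 0 → 4 * w ^ 3 - g₂ * w - g₃ = 0 →
      u ≠ v → w ≠ u → w ≠ v → w = -u - v := by
    intro u v w hu hv hw huv hwu hwv
    have ha := key hw hu hwu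
    have hb := key hw hv hwv
    have h : (u - v) * (w + u + v) = 0 := by linear_combination (ha - hb) / 4
    rcases mul_eq_zero.mp h with h | h
    · exact absurd (sub_eq_zero.mp h) huv
    · linear_combination h
  by_cases hr1 : r = e₁
  · exact Or.inl hr1
  by_cases hr2 : r = e₂
  · exact Or.inr (Or.inl hr2)
  right; right
  rw [third h₁ h₂ hr h12 hr1 hr2, third h₁ h₂ h₃ h12 h13.symm h23.symm]

/-! ## §2 Automorphisms of `ℂ` fix the half-period values -/

/-- **`σ(℘_{Λ_W} α) = ℘_{Λ_W} α`** for every automorphism `σ` of `ℂ`, in the index-`4` configuration (`Λ₁(f) ⊆ Λ_W ⊇ 2Λ₀(f)`, classes `0, α, β, γ`),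
GIVEN the anchor hypothesis: `σ` permutes the roots `e_α, e_β, e_γ` of `4x³ − g₂x − g₃` (`g₂, g₃ ∈ ℚ`), and each non-trivial move is excluded by
`false_of_conj_moves_class`. [cite: ShimuraIATAF1971, Thm. 3.52] -/
theorem ringEquiv_apply_weierstrassP_eq {W : WeierstrassCurve ℚ} [W.IsElliptic] [W.IsGloballyMinimal]
    (D : ModularParametrizationData W N)
    (hΛ₁ : ∀ z ∈ periodLatticeGamma1 D.f, z ∈ D.L.lattice) (h2 : ∀ w ∈ periodLattice D.f, 2 * w ∈ D.L.lattice)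
    (hAnchor : ∀ χ : SL(2, ℤ) → ℤ,
      (∀ γ ∈ Gamma0 N, χ γ = 1 ∨ χ γ = -1) → (∀ γ ∈ Gamma0 N, ∀ δ ∈ Gamma0 N, χ (γ * δ) = χ γ * χ δ) →
      (∀ γ ∈ Gamma0 N, ((γ 1 1 : ℤ) : ZMod N) = 1 → χ γ = 1) → (∀ γ ∈ Gamma0 N, γ 1 0 = 0 → χ γ = 1) →
      ∃ (N' : ℕ) (kg : ℤ) (g : ℍ → ℂ) (cg : ℕ → ℚ), N ∣ N' ∧ 0 < N' ∧ MDifferentiable 𝓘(ℂ) 𝓘(ℂ) g ∧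
        (∀ δ : SL(2, ℤ), IsBoundedAtImInfty (g ∣[kg] δ)) ∧ (∀ γ ∈ Gamma0 N', g ∣[kg] γ = ((χ γ : ℤ) : ℂ) • g) ∧
        (∀ τ : ℍ, HasSum (fun n : ℕ ↦ ((cg n : ℚ) : ℂ) * Function.Periodic.qParam 1 (τ : ℂ) ^ n) (g τ)) ∧ (∀ τ : ℍ, g τ ≠ 0))
    {α β γ : ℂ} (hα : α ∈ periodLattice D.f) (hβ : β ∈ periodLattice D.f) (hγ : γ ∈ periodLattice D.f)
    (hαW : α ∉ D.L.lattice) (hβW : β ∉ D.L.lattice) (hγW : γ ∉ D.L.lattice)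
    (hαβ : α - β ∉ D.L.lattice) (hαγ : α - γ ∉ D.L.lattice) (hβγ : β - γ ∉ D.L.lattice) (hsum : α + β - γ ∈ D.L.lattice)
    (hcover : ∀ w ∈ periodLattice D.f, w ∈ D.L.lattice ∨ w - α ∈ D.L.lattice ∨ w - β ∈ D.L.lattice ∨ w - γ ∈ D.L.lattice)
    (σ : ℂ ≃+* ℂ) : σ (℘[D.L] α) = ℘[D.L] α := by
  obtain ⟨h2α, h2β, h2γ, hαγβ, hβγα⟩ := triple_relations D h2 hα hβ hγ hsum
  -- `g₂, g₃ ∈ ℚ`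
  have hg₂ : D.L.g₂ = ((W.c₄ / 12 : ℚ) : ℂ) := by
    rw [D.isNeronLattice.1]; simp [WeierstrassCurve.baseChange, WeierstrassCurve.map_c₄]
  have hg₃ : D.L.g₃ = ((W.c₆ / 216 : ℚ) : ℂ) := by
    rw [D.isNeronLattice.2]; simp [WeierstrassCurve.baseChange, WeierstrassCurve.map_c₆]
  -- the three values are distinct roots of the cubic; `σ e_α` is a root
  have hroot : ∀ {w : ℂ}, w ∉ D.L.lattice → 2 * w ∈ D.L.lattice → 4 * ℘[D.L] w ^ 3 - D.L.g₂ * ℘[D.L] w - D.L.g₃ = 0 := by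
    intro w hw h2w
    have h0 : ℘'[D.L] w = 0 := by
      have := D.L.derivWeierstrassP_sub_coe w ⟨2 * w, h2w⟩
      rw [Subtype.coe_mk, show w - 2 * w = -w by ring, D.L.derivWeierstrassP_neg] at this
      have h2' : (2 : ℂ) * ℘'[D.L] w = 0 := by linear_combination -this
      simpa using h2'
    rw [← D.L.derivWeierstrassP_sq w hw, h0]; ring
  have hne : ∀ {u v : ℂ}, u ∉ D.L.lattice → v ∉ D.L.lattice → u - v ∉ D.L.lattice → u + v ∉ D.L.lattice → ℘[D.L] u ≠ ℘[D.L] v := by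
    intro u v hu hv huv huv' h
    rcases (D.L.weierstrassP_eq_weierstrassP_iff hu hv).mp h with h' | h'
    · exact huv' h'
    · exact huv h'
  have hαβ' : α + β ∉ D.L.lattice := fun h ↦ hγW (by have := sub_mem h hsum; have e : α + β - (α + β - γ) = γ := (by ring); rwa [e] at this)
  have hαγ' : α + γ ∉ D.L.lattice := fun h ↦ hβW (by have := sub_mem h hαγβ; have e : α + γ - (α + γ - β) = β := (by ring); rwa [e] at this)
  have hβγ' : β + γ ∉ D.L.lattice := fun h ↦ hαW (by have := sub_mem h hβγα; have e : β + γ - (β + γ - α) = α := (by ring); rwa [e] at this)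
  have hEαβ := hne hαW hβW hαβ hαβ'
  have hEαγ := hne hαW hγW hαγ hαγ'
  have hEβγ := hne hβW hγW hβγ hβγ'
  have hrα := hroot hαW h2α
  have hrβ := hroot hβW h2β
  have hrγ := hroot hγW h2γ
  have hσroot : ∀ {e : ℂ}, 4 * e ^ 3 - D.L.g₂ * e - D.L.g₃ = 0 → 4 * σ e ^ 3 - D.L.g₂ * σ e - D.L.g₃ = 0 := by
    intro e he
    have h := congrArg σ he
    rw [map_zero, map_sub, map_sub, map_mul, map_mul, map_pow, hg₂, hg₃, map_ratCast, map_ratCast, map_ofNat] at h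
    rw [hg₂, hg₃]; exact h
  have hinj : ∀ {u v : ℂ}, σ u = σ v → u = v := fun h ↦ σ.injective h
  -- hcover in the other orders
  have hcover_βαγ : ∀ w ∈ periodLattice D.f, w ∈ D.L.lattice ∨ w - β ∈ D.L.lattice ∨ w - α ∈ D.L.lattice ∨ w - γ ∈ D.L.lattice :=
    fun w hw ↦ by rcases hcover w hw with h | h | h | h <;> simp [h]
  have hcover_γαβ : ∀ w ∈ periodLattice D.f, w ∈ D.L.lattice ∨ w - γ ∈ D.L.lattice ∨ w - α ∈ D.L.lattice ∨ w - β ∈ D.L.lattice :=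
    fun w hw ↦ by rcases hcover w hw with h | h | h | h <;> simp [h]
  have hβα : β - α ∉ D.L.lattice := fun h ↦ hαβ (by simpa using neg_mem h)
  have hγα : γ - α ∉ D.L.lattice := fun h ↦ hαγ (by simpa using neg_mem h)
  have hγβ : γ - β ∉ D.L.lattice := fun h ↦ hβγ (by simpa using neg_mem h)
  have hsum_βαγ : β + α - γ ∈ D.L.lattice := by rwa [add_comm] at hsum
  have hsum_γαβ : γ + α - β ∈ D.L.lattice := by rwa [add_comm] at hαγβ
  -- case analysis on `σ e_α`
  rcases cubic_root_cases hrα hrβ hrγ (hσroot hrα) hEαβ hEαγ hEβγ with hA | hA | hA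
  · exact hA
  · -- `σ e_α = e_β`: then `{σ e_β, σ e_γ} = {e_α, e_γ}`; core with the triple `(β, α, γ)`
    exfalso
    have hB : σ (℘[D.L] β) = ℘[D.L] α ∨ σ (℘[D.L] β) = ℘[D.L] γ := by
      rcases cubic_root_cases hrα hrβ hrγ (hσroot hrβ) hEαβ hEαγ hEβγ with h | h | h
      · exact Or.inl h
      · exact absurd (hinj (h.trans hA.symm)) hEαβ.symm
      · exact Or.inr h
    have hC : (σ (℘[D.L] β) = ℘[D.L] α ∧ σ (℘[D.L] γ) = ℘[D.L] γ) ∨ (σ (℘[D.L] β) = ℘[D.L] γ ∧ σ (℘[D.L] γ) = ℘[D.L] α) := by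
      rcases cubic_root_cases hrα hrβ hrγ (hσroot hrγ) hEαβ hEαγ hEβγ with h | h | h
      · rcases hB with hB | hB
        · exact absurd (hinj (hB.trans h.symm)) hEβγ
        · exact Or.inr ⟨hB, h⟩
      · exact absurd (hinj (h.trans hA.symm)) hEαγ.symm
      · rcases hB with hB | hB
        · exact Or.inl ⟨hB, h⟩
        · exact absurd (hinj (hB.trans h.symm)) hEβγ
    exact false_of_conj_moves_class D hΛ₁ h2 hAnchor hα hβ hγ hαW hβW hγW hαβ hαγ hsum hcover
      hβ hα hγ hβW hαW hγW hβα hβγ hsum_βαγ hcover_βαγ σ hA hC hαβ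
  · -- `σ e_α = e_γ`: core with the triple `(γ, α, β)`
    exfalso
    have hB : σ (℘[D.L] β) = ℘[D.L] α ∨ σ (℘[D.L] β) = ℘[D.L] β := by
      rcases cubic_root_cases hrα hrβ hrγ (hσroot hrβ) hEαβ hEαγ hEβγ with h | h | h
      · exact Or.inl h
      · exact Or.inr h
      · exact absurd (hinj (h.trans hA.symm)) hEαβ.symm
    have hC : (σ (℘[D.L] β) = ℘[D.L] α ∧ σ (℘[D.L] γ) = ℘[D.L] β) ∨ (σ (℘[D.L] β) = ℘[D.L] β ∧ σ (℘[D.L] γ) = ℘[D.L] α) := by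
      rcases cubic_root_cases hrα hrβ hrγ (hσroot hrγ) hEαβ hEαγ hEβγ with h | h | h
      · rcases hB with hB | hB
        · exact absurd (hinj (hB.trans h.symm)) hEβγ
        · exact Or.inr ⟨hB, h⟩
      · rcases hB with hB | hB
        · exact Or.inl ⟨hB, h⟩
        · exact absurd (hinj (hB.trans h.symm)) hEβγ
      · exact absurd (hinj (h.trans hA.symm)) hEαγ.symm
    exact false_of_conj_moves_class D hΛ₁ h2 hAnchor hα hβ hγ hαW hβW hγW hαβ hαγ hsum hcover
      hγ hα hβ hγW hαW hβW hγα hγβ hsum_γαβ hcover_γαβ σ hA hC hαγ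

/-- **The half-period value `℘_{Λ_W}(α)` is RATIONAL** (index-`4` configuration, GIVEN the anchor hypothesis): it is fixed by every automorphism of `ℂ`,
and the fixed field of `Aut ℂ` is `ℚ`. [cite: Cox2013, §10.C proof of Thm. 10.23] -/
theorem exists_ratCast_eq_weierstrassP {W : WeierstrassCurve ℚ} [W.IsElliptic] [W.IsGloballyMinimal]
    (D : ModularParametrizationData W N)
    (hΛ₁ : ∀ z ∈ periodLatticeGamma1 D.f, z ∈ D.L.lattice) (h2 : ∀ w ∈ periodLattice D.f, 2 * w ∈ D.L.lattice)
    (hAnchor : ∀ χ : SL(2, ℤ) → ℤ,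
      (∀ γ ∈ Gamma0 N, χ γ = 1 ∨ χ γ = -1) → (∀ γ ∈ Gamma0 N, ∀ δ ∈ Gamma0 N, χ (γ * δ) = χ γ * χ δ) →
      (∀ γ ∈ Gamma0 N, ((γ 1 1 : ℤ) : ZMod N) = 1 → χ γ = 1) → (∀ γ ∈ Gamma0 N, γ 1 0 = 0 → χ γ = 1) →
      ∃ (N' : ℕ) (kg : ℤ) (g : ℍ → ℂ) (cg : ℕ → ℚ), N ∣ N' ∧ 0 < N' ∧ MDifferentiable 𝓘(ℂ) 𝓘(ℂ) g ∧
        (∀ δ : SL(2, ℤ), IsBoundedAtImInfty (g ∣[kg] δ)) ∧ (∀ γ ∈ Gamma0 N', g ∣[kg] γ = ((χ γ : ℤ) : ℂ) • g) ∧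
        (∀ τ : ℍ, HasSum (fun n : ℕ ↦ ((cg n : ℚ) : ℂ) * Function.Periodic.qParam 1 (τ : ℂ) ^ n) (g τ)) ∧ (∀ τ : ℍ, g τ ≠ 0))
    {α β γ : ℂ} (hα : α ∈ periodLattice D.f) (hβ : β ∈ periodLattice D.f) (hγ : γ ∈ periodLattice D.f)
    (hαW : α ∉ D.L.lattice) (hβW : β ∉ D.L.lattice) (hγW : γ ∉ D.L.lattice)
    (hαβ : α - β ∉ D.L.lattice) (hαγ : α - γ ∉ D.L.lattice) (hβγ : β - γ ∉ D.L.lattice) (hsum : α + β - γ ∈ D.L.lattice)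
    (hcover : ∀ w ∈ periodLattice D.f, w ∈ D.L.lattice ∨ w - α ∈ D.L.lattice ∨ w - β ∈ D.L.lattice ∨ w - γ ∈ D.L.lattice) :
    ∃ q : ℚ, (q : ℂ) = ℘[D.L] α :=
  Literature.NumberTheory.EllipticCurves.exists_ratCast_eq_of_forall_ringEquiv fun σ ↦
    ringEquiv_apply_weierstrassP_eq D hΛ₁ h2 hAnchor hα hβ hγ hαW hβW hγW hαβ hαγ hβγ hsum hcover σ

/-! ## §3 From a rational half-period value to a rational `2`-torsion abscissa -/

/-- **A rational half-period value of the Néron lattice is a rational `2`-torsion abscissa**: if `℘_{Λ_W}(w) = q ∈ ℚ` for a half-period `w` of the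
Néron pair of `W` (`g₂ = c₄/12`, `g₃ = c₆/216`), then `x = q − b₂/12` satisfies `4x³ + b₂x² + 2b₄x + b₆ = 0`, i.e. `(x, −(a₁x + a₃)/2)` is a rational
point of order `2` on `W` (Greenberg's `HasRationalTwoTorsionX`). [cite: SilvermanAEC2009, III.1 (b- and c-invariants) and VI.3.6] -/
theorem hasRationalTwoTorsionX_of_ratCast_eq {W : WeierstrassCurve ℚ} (D : ModularParametrizationData W N) {w : ℂ} (hw : w ∉ D.L.lattice)
    (h2w : 2 * w ∈ D.L.lattice) {q : ℚ} (hq : (q : ℂ) = ℘[D.L] w) :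
    Literature.NumberTheory.EllipticCurves.Greenberg1999.HasRationalTwoTorsionX W (q - W.b₂ / 12) := by
  -- the cubic relation over `ℚ`
  have hg₂ : D.L.g₂ = ((W.c₄ / 12 : ℚ) : ℂ) := by
    rw [D.isNeronLattice.1]; simp [WeierstrassCurve.baseChange, WeierstrassCurve.map_c₄]
  have hg₃ : D.L.g₃ = ((W.c₆ / 216 : ℚ) : ℂ) := by
    rw [D.isNeronLattice.2]; simp [WeierstrassCurve.baseChange, WeierstrassCurve.map_c₆]
  have h0 : ℘'[D.L] w = 0 := by
    have := D.L.derivWeierstrassP_sub_coe w ⟨2 * w, h2w⟩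
    rw [Subtype.coe_mk, show w - 2 * w = -w by ring, D.L.derivWeierstrassP_neg] at this
    have h2' : (2 : ℂ) * ℘'[D.L] w = 0 := by linear_combination -this
    simpa using h2'
  have hcubicC : 4 * (q : ℂ) ^ 3 - ((W.c₄ / 12 : ℚ) : ℂ) * (q : ℂ) - ((W.c₆ / 216 : ℚ) : ℂ) = 0 := by
    rw [← hg₂, ← hg₃, hq, ← D.L.derivWeierstrassP_sq w hw, h0]; ring
  have hcubic : 4 * q ^ 3 - W.c₄ / 12 * q - W.c₆ / 216 = 0 := by exact_mod_cast hcubicC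
  refine ⟨-(W.a₁ * (q - W.b₂ / 12) + W.a₃) / 2, ?_, by ring⟩
  rw [WeierstrassCurve.Affine.equation_iff]
  rw [WeierstrassCurve.c₄, WeierstrassCurve.c₆, WeierstrassCurve.b₂, WeierstrassCurve.b₄, WeierstrassCurve.b₆] at hcubic
  rw [WeierstrassCurve.b₂]
  linear_combination (-1 / 4 : ℚ) * hcubic


/-! ## §4 The index-`4` configuration with `|c₀| = 2`: the three classes are `ω₁/2, ω₂/2, (ω₁+ω₂)/2` -/

/-- **E-an-152d♭ (anchor form): index `4` ∧ `|c₀| = 2` ⟹ THREE RATIONAL `2`-TORSION ABSCISSAE.**  For a globally minimal `W`, an `X₀(N)`-datum with the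
lattice clause `Λ_W = c₀Λ₀(f)`, `|c₀| = 2` and the index-`4` configuration `Λ₁(f) = 2Λ₀(f)`, GIVEN the anchor hypothesis at level `N`, the curve `W`
has three distinct rational `2`-torsion abscissae (Greenberg's `HasRationalTwoTorsionX`).  Proof: `Λ₀ = ½Λ_W`, classes `ω₁/2, ω₂/2, (ω₁+ω₂)/2`
(coordinates in the basis `ω₁, ω₂`); `exists_ratCast_eq_weierstrassP` for each class; `hasRationalTwoTorsionX_of_ratCast_eq`.
CONDITIONAL on the anchor hypothesis (explicit binder); E-an-152d as typed, C2, Manin's conjecture and BSD are not proved here.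
[cite: ShimuraIATAF1971, Thm. 3.52] [cite: Stevens1989, §2] -/
theorem exists_three_hasRationalTwoTorsionX_of_indexFour_of_anchor {W : WeierstrassCurve ℚ} [W.IsElliptic] [W.IsGloballyMinimal]
    (D : ModularParametrizationData W N)
    (hopt : ∀ z ∈ D.L.lattice, ∃ w ∈ periodLattice D.f, z = D.c * w) (hc2 : D.c.natAbs = 2)
    (hidx : ∀ z : ℂ, z ∈ periodLatticeGamma1 D.f ↔ ∃ w ∈ periodLattice D.f, z = 2 * w)
    (hAnchor : ∀ χ : SL(2, ℤ) → ℤ,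
      (∀ γ ∈ Gamma0 N, χ γ = 1 ∨ χ γ = -1) → (∀ γ ∈ Gamma0 N, ∀ δ ∈ Gamma0 N, χ (γ * δ) = χ γ * χ δ) →
      (∀ γ ∈ Gamma0 N, ((γ 1 1 : ℤ) : ZMod N) = 1 → χ γ = 1) → (∀ γ ∈ Gamma0 N, γ 1 0 = 0 → χ γ = 1) →
      ∃ (N' : ℕ) (kg : ℤ) (g : ℍ → ℂ) (cg : ℕ → ℚ), N ∣ N' ∧ 0 < N' ∧ MDifferentiable 𝓘(ℂ) 𝓘(ℂ) g ∧
        (∀ δ : SL(2, ℤ), IsBoundedAtImInfty (g ∣[kg] δ)) ∧ (∀ γ ∈ Gamma0 N', g ∣[kg] γ = ((χ γ : ℤ) : ℂ) • g) ∧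
        (∀ τ : ℍ, HasSum (fun n : ℕ ↦ ((cg n : ℚ) : ℂ) * Function.Periodic.qParam 1 (τ : ℂ) ^ n) (g τ)) ∧ (∀ τ : ℍ, g τ ≠ 0)) :
    ∃ x₁ x₂ x₃ : ℚ, x₁ ≠ x₂ ∧ x₁ ≠ x₃ ∧ x₂ ≠ x₃ ∧
      Literature.NumberTheory.EllipticCurves.Greenberg1999.HasRationalTwoTorsionX W x₁ ∧
      Literature.NumberTheory.EllipticCurves.Greenberg1999.HasRationalTwoTorsionX W x₂ ∧
      Literature.NumberTheory.EllipticCurves.Greenberg1999.HasRationalTwoTorsionX W x₃ := by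
  -- `c = ±2`
  have hc : D.c = 2 ∨ D.c = -2 := by
    rcases Int.natAbs_eq D.c with h | h <;> [left; right] <;> rw [h, hc2] <;> norm_num
  -- `Λ₀ ⊆ ½Λ_W`, `Λ_W ⊆ 2Λ₀`, `Λ₁ ⊆ Λ_W`
  have h2 : ∀ w ∈ periodLattice D.f, 2 * w ∈ D.L.lattice := by
    intro w hw
    have h := D.smul_periodLattice_le w hw
    rcases hc with hc | hc
    · rw [hc] at h; exact_mod_cast h
    · rw [hc] at h
      have : (2 : ℂ) * w = -(((-2 : ℤ) : ℂ) * w) := by push_cast; ring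
      rw [this]; exact neg_mem h
  have hhalf : ∀ z ∈ D.L.lattice, ∃ w ∈ periodLattice D.f, z = 2 * w := by
    intro z hz
    obtain ⟨w, hw, hzw⟩ := hopt z hz
    rcases hc with hc | hc
    · exact ⟨w, hw, by rw [hzw, hc]; push_cast; ring⟩
    · exact ⟨-w, neg_mem hw, by rw [hzw, hc]; push_cast; ring⟩
  have hΛ₁ : ∀ z ∈ periodLatticeGamma1 D.f, z ∈ D.L.lattice := by
    intro z hz
    obtain ⟨w, hw, rfl⟩ := (hidx z).mp hz
    exact h2 w hw
  -- the half-periods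
  set η₁ : ℂ := D.L.ω₁ / 2 with hη₁
  set η₂ : ℂ := D.L.ω₂ / 2 with hη₂
  have hη₁Λ : η₁ ∈ periodLattice D.f := by
    obtain ⟨w, hw, h⟩ := hhalf D.L.ω₁ D.L.ω₁_mem_lattice
    have : η₁ = w := by rw [hη₁, h]; ring
    rw [this]; exact hw
  have hη₂Λ : η₂ ∈ periodLattice D.f := by
    obtain ⟨w, hw, h⟩ := hhalf D.L.ω₂ D.L.ω₂_mem_lattice
    have : η₂ = w := by rw [hη₂, h]; ring
    rw [this]; exact hw
  have hη₃Λ : η₁ + η₂ ∈ periodLattice D.f := add_mem hη₁Λ hη₂Λ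
  -- coordinates: `a/2·ω₁ + b/2·ω₂ ∈ Λ_W ↔ a, b even`
  have hcoord : ∀ a b : ℤ, ((a : ℂ) / 2) * D.L.ω₁ + ((b : ℂ) / 2) * D.L.ω₂ ∈ D.L.lattice ↔ (2 ∣ a ∧ 2 ∣ b) := by
    intro a b
    have h := PeriodPair.mul_ω₁_add_mul_ω₂_mem_lattice (L := D.L) (α := (a : ℚ) / 2) (β := (b : ℚ) / 2)
    have e : (((a : ℚ) / 2 : ℚ) : ℂ) * D.L.ω₁ + (((b : ℚ) / 2 : ℚ) : ℂ) * D.L.ω₂ = ((a : ℂ) / 2) * D.L.ω₁ + ((b : ℂ) / 2) * D.L.ω₂ := by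
      push_cast; ring
    rw [e] at h
    rw [h]
    have hden : ∀ m : ℤ, ((m : ℚ) / 2).den = 1 ↔ 2 ∣ m := by
      intro m
      constructor
      · intro hd
        have hq : ((m : ℚ) / 2) = (((m : ℚ) / 2).num : ℚ) := by
          conv_lhs => rw [← Rat.num_div_den ((m : ℚ) / 2)]
          rw [hd]; simp
        refine ⟨((m : ℚ) / 2).num, ?_⟩
        have : (m : ℚ) = 2 * ((((m : ℚ) / 2).num : ℤ) : ℚ) := by rw [← hq]; ring
        exact_mod_cast this
      · rintro ⟨k, rfl⟩
        have : ((2 * k : ℤ) : ℚ) / 2 = (k : ℚ) := by push_cast; ring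
        rw [this]; exact Rat.den_intCast k
    rw [hden a, hden b]
  have hmemW : ∀ {a b : ℤ} (z : ℂ), z = ((a : ℂ) / 2) * D.L.ω₁ + ((b : ℂ) / 2) * D.L.ω₂ → (z ∈ D.L.lattice ↔ (2 ∣ a ∧ 2 ∣ b)) :=
    fun z hz ↦ by rw [hz]; exact hcoord _ _
  have hη₁W : η₁ ∉ D.L.lattice := fun h ↦ by
    have := (hmemW (a := 1) (b := 0) η₁ (by rw [hη₁]; push_cast; ring)).mp h; omega
  have hη₂W : η₂ ∉ D.L.lattice := fun h ↦ by
    have := (hmemW (a := 0) (b := 1) η₂ (by rw [hη₂]; push_cast; ring)).mp h; omega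
  have hη₃W : η₁ + η₂ ∉ D.L.lattice := fun h ↦ by
    have := (hmemW (a := 1) (b := 1) (η₁ + η₂) (by rw [hη₁, hη₂]; push_cast; ring)).mp h; omega
  have h12 : η₁ - η₂ ∉ D.L.lattice := fun h ↦ by
    have := (hmemW (a := 1) (b := -1) (η₁ - η₂) (by rw [hη₁, hη₂]; push_cast; ring)).mp h; omega
  have h13 : η₁ - (η₁ + η₂) ∉ D.L.lattice := fun h ↦ by
    have := (hmemW (a := 0) (b := -1) (η₁ - (η₁ + η₂)) (by rw [hη₂]; push_cast; ring)).mp h; omega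
  have h23 : η₂ - (η₁ + η₂) ∉ D.L.lattice := fun h ↦ by
    have := (hmemW (a := -1) (b := 0) (η₂ - (η₁ + η₂)) (by rw [hη₁]; push_cast; ring)).mp h; omega
  have hsum : η₁ + η₂ - (η₁ + η₂) ∈ D.L.lattice := by rw [sub_self]; exact zero_mem _
  -- every class is one of `0, η₁, η₂, η₁ + η₂`
  have hcover : ∀ w ∈ periodLattice D.f, w ∈ D.L.lattice ∨ w - η₁ ∈ D.L.lattice ∨ w - η₂ ∈ D.L.lattice ∨ w - (η₁ + η₂) ∈ D.L.lattice := by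
    intro w hw
    obtain ⟨m, n, hmn⟩ := PeriodPair.mem_lattice.mp (h2 w hw)
    have hw' : w = ((m : ℂ) / 2) * D.L.ω₁ + ((n : ℂ) / 2) * D.L.ω₂ := by linear_combination -hmn / 2
    rcases Int.even_or_odd m with ⟨i, hi⟩ | ⟨i, hi⟩ <;> rcases Int.even_or_odd n with ⟨j, hj⟩ | ⟨j, hj⟩
    · exact Or.inl ((hmemW w hw').mpr ⟨⟨i, by omega⟩, ⟨j, by omega⟩⟩)
    · refine Or.inr (Or.inr (Or.inl ((hmemW (a := m) (b := n - 1) _ (by rw [hw', hη₂]; push_cast; ring)).mpr ⟨⟨i, by omega⟩, ⟨j, by omega⟩⟩)))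
    · refine Or.inr (Or.inl ((hmemW (a := m - 1) (b := n) _ (by rw [hw', hη₁]; push_cast; ring)).mpr ⟨⟨i, by omega⟩, ⟨j, by omega⟩⟩))
    · refine Or.inr (Or.inr (Or.inr ((hmemW (a := m - 1) (b := n - 1) _ (by rw [hw', hη₁, hη₂]; push_cast; ring)).mpr
        ⟨⟨i, by omega⟩, ⟨j, by omega⟩⟩)))
  have hcover' : ∀ w ∈ periodLattice D.f, w ∈ D.L.lattice ∨ w - η₂ ∈ D.L.lattice ∨ w - η₁ ∈ D.L.lattice ∨ w - (η₁ + η₂) ∈ D.L.lattice :=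
    fun w hw ↦ by rcases hcover w hw with h | h | h | h <;> simp [h]
  have hcover'' : ∀ w ∈ periodLattice D.f, w ∈ D.L.lattice ∨ w - (η₁ + η₂) ∈ D.L.lattice ∨ w - η₁ ∈ D.L.lattice ∨ w - η₂ ∈ D.L.lattice :=
    fun w hw ↦ by rcases hcover w hw with h | h | h | h <;> simp [h]
  -- the three rational values
  have h21 : η₂ - η₁ ∉ D.L.lattice := fun h ↦ h12 (by simpa using neg_mem h)
  have h31 : η₁ + η₂ - η₁ ∉ D.L.lattice := fun h ↦ h13 (by simpa using neg_mem h)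
  have h32 : η₁ + η₂ - η₂ ∉ D.L.lattice := fun h ↦ h23 (by simpa using neg_mem h)
  obtain ⟨q₁, hq₁⟩ := exists_ratCast_eq_weierstrassP D hΛ₁ h2 hAnchor hη₁Λ hη₂Λ hη₃Λ hη₁W hη₂W hη₃W h12 h13 h23 hsum hcover
  obtain ⟨q₂, hq₂⟩ := exists_ratCast_eq_weierstrassP D hΛ₁ h2 hAnchor hη₂Λ hη₁Λ hη₃Λ hη₂W hη₁W hη₃W h21 h23 h13
    (by rw [add_comm η₂ η₁, sub_self]; exact zero_mem _) hcover'
  obtain ⟨q₃, hq₃⟩ := exists_ratCast_eq_weierstrassP D hΛ₁ h2 hAnchor hη₃Λ hη₁Λ hη₂Λ hη₃W hη₁W hη₂W h31 h32 h12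
    (by have e : η₁ + η₂ + η₁ - η₂ = 2 * η₁ := (by ring); rw [e]; exact h2 η₁ hη₁Λ) hcover''
  -- distinct
  have hne : ∀ {u v : ℂ}, u ∉ D.L.lattice → v ∉ D.L.lattice → u - v ∉ D.L.lattice → u + v ∉ D.L.lattice → ℘[D.L] u ≠ ℘[D.L] v := by
    intro u v hu hv huv huv' h
    rcases (D.L.weierstrassP_eq_weierstrassP_iff hu hv).mp h with h' | h'
    · exact huv' h'
    · exact huv h'
  have hd12 : ℘[D.L] η₁ ≠ ℘[D.L] η₂ := hne hη₁W hη₂W h12 hη₃W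
  have hd13 : ℘[D.L] η₁ ≠ ℘[D.L] (η₁ + η₂) := hne hη₁W hη₃W h13 (fun h ↦ by
    have := (hmemW (a := 2) (b := 1) _ (by rw [hη₁, hη₂]; push_cast; ring)).mp h; omega)
  have hd23 : ℘[D.L] η₂ ≠ ℘[D.L] (η₁ + η₂) := hne hη₂W hη₃W h23 (fun h ↦ by
    have := (hmemW (a := 1) (b := 2) _ (by rw [hη₁, hη₂]; push_cast; ring)).mp h; omega)
  refine ⟨q₁ - W.b₂ / 12, q₂ - W.b₂ / 12, q₃ - W.b₂ / 12, ?_, ?_, ?_,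
    hasRationalTwoTorsionX_of_ratCast_eq D hη₁W (h2 η₁ hη₁Λ) hq₁, hasRationalTwoTorsionX_of_ratCast_eq D hη₂W (h2 η₂ hη₂Λ) hq₂,
    hasRationalTwoTorsionX_of_ratCast_eq D hη₃W (h2 _ hη₃Λ) hq₃⟩
  · intro h; apply hd12; rw [← hq₁, ← hq₂]; exact_mod_cast sub_left_injective h
  · intro h; apply hd13; rw [← hq₁, ← hq₃]; exact_mod_cast sub_left_injective h
  · intro h; apply hd23; rw [← hq₂, ← hq₃]; exact_mod_cast sub_left_injective h

end Summit.BirchSwinnertonDyer.BirchSwinnertonDyer.Theorems.ManinLocalTwoThree.CDivTranslate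

end
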